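import Summits.HodgeConjecture.HodgeConjecture.Theorems.Ring2AtlasWeilCarriersEEFloccariFu
import Summits.HodgeConjecture.HodgeConjecture.Theorems.Ring2AbelianAllOddTimesCurve
import Summits.HodgeConjecture.HodgeConjecture.Theorems.Ring2AbelianAllWeilHyperbolicDescent
import Literature.AlgebraicGeometry.Motives.AbelianVarietyPoincareCompleteReducibility
import HarnessLib

/-!
# Ring 2 · atlas-2 (generation 12), part 3 — the carrier tenfolds `Y₄ × Z₃²`: the SPLIT-SIXFOLD slice
`Y'₄ × E₀²` discharged from ONE hyperbolic-sixfold statement (Koike / Schoen refereed; Markman F2 unrefereed)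

HONEST FRAMING: research route conditional on HC_CM; not a corollary; Q11.4-sentence-2 already refuted in dim ≥ 3.

Cell `pub-hodge-ring2`, seat `pub-hodge-ring2-atlas-2` (generation 12). Sequel of `Ring2AtlasWeilCarriersEE` (p205760)
and `Ring2AtlasWeilCarriersEEFloccariFu` (p206161). There, `HC(T)` for a Weil-type `(5,5)` tenfold
`T = Y × Z × Z` (`dim Y = 4`, `dim Z = 3`, `K = ℚ(√-d)` diagonal) with divisor-and-Weil-generated Hodge ring was
reduced to Floccari–Fu 2026 (refereed named fact, the fourfold slice) and ONE remaining input: the Weil classes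
of the Weil-type `(3,3)` SPLIT SIXFOLDS `Y' × E₀ × E₀` (`dim Y' = 4`, `E₀` a CM curve), asked in the shape
`Y'.prod (E₀.prod E₀)` with the structure `ψ' × (ψ₀ × ψ₀)`. The AbelianAll seat (`ab-weil-2`, gen 3,
`Ring2AbelianAllOddTimesCurve`, p205880) proved that EVERY Weil-type pair `A × E` with `dim A` ODD is of SPLIT
(hyperbolic) Weil type (weighted Segre polarisation + van Geemen 5.2 (4) + Landherr; no named fact) and hence that
the Weil classes of `Y₅ × E` follow from ONE hyperbolic-sixfold statement by name — Koike 2004 (`K = ℚ(i)`,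
refereed), Schoen 1998 (`K = ℚ(√-3)`, refereed) or Markman's F2 (any `K`, UNREFEREED). This file carries that
to the carrier cells:

* §1 (unconditional bookkeeping) re-association `A × (B × C) ≅ (A × B) × C` of a diagonal `K`-structure:
  `isWeilType_prod_prod_assoc` (Weil type `(n,n)` re-associates — multiplicities of `i√d` on `H^{1,0}` add over
  products, part 1 §1) and `weilAlgebraicFor_prod_prod_assoc` (algebraicity of the Weil classes re-associates —
  the associator is a `K`-equivariant ISOMORPHISM, in particular an isogeny with quasi-inverse of exponent `1`, so
  the AbelianAll seat's transport lemma `weilAlgebraicFor_of_descent` applies with `m = 1`).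
* §2 the split-sixfold slice IN THE SHAPE CONSUMED BY PART 2: `weilAlgebraicFor_three_fourfold_prod_curve_sq_of_
  {markmanSixfolds, koike, schoen}` — Weil classes on `(Y' × (E₀ × E₀), ψ' × (ψ₀ × ψ₀))` of type `(3,3)` are
  algebraic granted F2 (any `d`) / Koike 2004 (`d = 1`) / Schoen 1998 (`d = 3`) ALONE, via §1 and the AbelianAll
  seat's `weilClasses_algebraic_fivefold_prod_curve_of_*` with `A := Y' × E₀` (a fivefold).
* §3 TENFOLD ROWS (per member): `HC(T)` for every Weil-type `(5,5)` tenfold `T = Y × Z × Z` with divisor-and-Weil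
  generated Hodge ring ⟸ Floccari–Fu + F2 (any `d`); ⟸ Floccari–Fu + Koike 2004 (`d = 1`: BOTH inputs REFEREED);
  ⟸ Floccari–Fu + Schoen 1998 (`d = 3`: BOTH inputs REFEREED).
* §4 CELL ROWS: both carrier cells `HodgeQuarticFieldFourfoldCMThreefoldSquaredCarrier`,
  `HodgeQuadraticFourfold31CMThreefoldSquaredCarrier` ⟸ the typed cell hypothesis `(S+G)_T` of part 1 (CELL
  INFERENCE, engine-certified on the cells' Mumford–Tate models, RELCHAR §5 and ERRATA-G11 §5; entered as an
  argument, never asserted) + Floccari–Fu 2026 Thm. 1.2 (refereed named fact) + Markman's hyperbolic-sixfold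
  statement F2 (UNREFEREED named fact). No tenfold input, no sixfold route item (`W₆`), no general fourfold fact.

KIND of `HC_CM` (`Theses.RankFourFaces.CMAbelianHodge`) on every row: ABSENT (it does not occur in this file).
PRINT STATUS (numbers, not adjectives): with `(S+G)_T` granted, the members with `K = ℚ(i)` or `K = ℚ(√-3)` of
both carrier cells are decided by REFEREED print alone (Koike 2004 Thm. 2.1 / Cor. 2.1, resp. Schoen 1998 §10–13,
plus Floccari–Fu 2026 Thm. 1.2); for other `K` the one unrefereed input is Markman arXiv:2502.03415 Thm. 1.5.1
(discriminant `-1` sixfolds). `(S+G)_T` itself is NOT in print and NOT kernel-proved for these tenfolds.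

Sources: [cite: Koike2004WeilHodge, Thm. 2.1 and Cor. 2.1] [cite: Schoen1998HodgeWeilAddendum, §10]
[cite: Markman2025SecantWeil, Thm. 1.5.1] [cite: FloccariFu2026, Theorem 1.2]
[cite: vanGeemen1994HodgeAV, Lemma 5.2 (2)–(4), 5.4, (5.4.1), Thm. 6.12] [cite: Landherr1936HermitianForms]
[cite: MoonenZarhin1999LowDim, Thm. 0.1 (a), §2 (2.5)(2), §5 Case 2] [cite: MoonenZarhin1998WeilClasses, §1 and Criterion (4.1)]
[cite: Deligne1982HodgeCycles, §5 (c)] [cite: MumfordAV1970, §19 Thm. 3] [cite: LangeBirkenhake1992, §1.1]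
-/

open CategoryTheory

namespace Summit.HodgeConjecture.HodgeConjecture.Ring2.Atlas

open Literature.AlgebraicGeometry Literature.AlgebraicGeometry.Motives
open Literature.AlgebraicGeometry.HodgeTheory
open Literature.AlgebraicTopology.SingularHomology
open Summit.HodgeConjecture.HodgeConjecture.Theses
open Summit.HodgeConjecture.HodgeConjecture.Ring2.Hypotheses
open Summit.HodgeConjecture.HodgeConjecture.Ring2.AbelianAll
open Summit.HodgeConjecture.HodgeConjecture.Cruxes.HodgeAbelianVarieties.EStepSecantInduction
  (WeilAlgebraicFor WeilAlgebraicAll)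

/-! ## §1 Re-association of a diagonal `K`-structure (unconditional bookkeeping) -/

section Assoc

variable {A B C : AbelianVariety ℂ} {n d : ℕ} {α : A ⟶ A} {β : B ⟶ B} {γ : C ⟶ C}

/-- **Weil type re-associates.** If `(A × (B × C), α × (β × γ))` is of Weil type `(n, n)` for `K = ℚ(√-d)`
(`α² = β² = γ² = -d`), so is `((A × B) × C, (α × β) × γ)`: the multiplicity of `i√d` on `H^{1,0}` is additive over
products (`eigenMultiplicity_prodLift`, part 1 §1), hence equal to `n` for both bracketings.
[cite: LangeBirkenhake1992, §1.1 (p. 19)] [cite: vanGeemen1994HodgeAV, 4.9–4.10] -/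
theorem isWeilType_prod_prod_assoc (hα : α ≫ α = -(d • 𝟙 A)) (hβ : β ≫ β = -(d • 𝟙 B))
    (hγ : γ ≫ γ = -(d • 𝟙 C))
    (hW : IsWeilType (A.prod (B.prod C))
      (AbelianVariety.prodLift (AbelianVariety.fst A (B.prod C) ≫ α)
        (AbelianVariety.snd A (B.prod C) ≫
          AbelianVariety.prodLift (AbelianVariety.fst B C ≫ β) (AbelianVariety.snd B C ≫ γ))) n d) :
    IsWeilType ((A.prod B).prod C)
      (AbelianVariety.prodLift
        (AbelianVariety.fst (A.prod B) C ≫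
          AbelianVariety.prodLift (AbelianVariety.fst A B ≫ α) (AbelianVariety.snd A B ≫ β))
        (AbelianVariety.snd (A.prod B) C ≫ γ)) n d := by
  have hm := eigenMultiplicity_eq_of_isWeilType hW
  rw [eigenMultiplicity_prodLift, eigenMultiplicity_prodLift] at hm
  have hdim' := hW.dim_eq
  rw [AbelianVariety.dim_prod, AbelianVariety.dim_prod] at hdim'
  have hdim : ((A.prod B).prod C).dim = 2 * n := by
    rw [AbelianVariety.dim_prod, AbelianVariety.dim_prod]
    omega
  refine isWeilType_of_eigenMultiplicity_eq hW.pos hW.d_pos hdim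
    (prodLift_comp_self_eq_neg_nsmul (prodLift_comp_self_eq_neg_nsmul hα hβ) hγ) ?_
  rw [eigenMultiplicity_prodLift, eigenMultiplicity_prodLift]
  omega

/-- **Algebraicity of the Weil classes re-associates.** If the Weil classes of `((A × B) × C, (α × β) × γ)` in
half-dimension `n` for `K = ℚ(√-d)` are algebraic, so are those of `(A × (B × C), α × (β × γ))`. The associator
`A × (B × C) → (A × B) × C` is a `K`-EQUIVARIANT ISOMORPHISM of abelian varieties (componentwise identities;
`AbelianVariety.prod_hom_ext`), in particular an isogeny whose inverse is a quasi-inverse of exponent `1`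
(`AbelianVariety.isIsogeny_hom_of_iso`), so the AbelianAll seat's transport of Weil classes along a descent datum
(`weilAlgebraicFor_of_descent`, `m = 1`: pull back along the inverse, push along the flat isomorphism) applies.
[cite: MoonenZarhin1998WeilClasses, §1] [cite: MumfordAV1970, §19 Thm. 3] [cite: vanGeemen1994HodgeAV, 5.2] -/
theorem weilAlgebraicFor_prod_prod_assoc (hd : 0 < d) (hα : α ≫ α = -(d • 𝟙 A)) (hβ : β ≫ β = -(d • 𝟙 B))
    (hγ : γ ≫ γ = -(d • 𝟙 C)) (hdim : (A.prod (B.prod C)).dim = 2 * n)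
    (hW : WeilAlgebraicFor n d ((A.prod B).prod C)
      (AbelianVariety.prodLift
        (AbelianVariety.fst (A.prod B) C ≫
          AbelianVariety.prodLift (AbelianVariety.fst A B ≫ α) (AbelianVariety.snd A B ≫ β))
        (AbelianVariety.snd (A.prod B) C ≫ γ))) :
    WeilAlgebraicFor n d (A.prod (B.prod C))
      (AbelianVariety.prodLift (AbelianVariety.fst A (B.prod C) ≫ α)
        (AbelianVariety.snd A (B.prod C) ≫
          AbelianVariety.prodLift (AbelianVariety.fst B C ≫ β) (AbelianVariety.snd B C ≫ γ))) := by
  -- the associator `a : A × (B × C) ⟶ (A × B) × C` and its inverse `b`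
  set a : A.prod (B.prod C) ⟶ (A.prod B).prod C :=
    AbelianVariety.prodLift
      (AbelianVariety.prodLift (AbelianVariety.fst A (B.prod C))
        (AbelianVariety.snd A (B.prod C) ≫ AbelianVariety.fst B C))
      (AbelianVariety.snd A (B.prod C) ≫ AbelianVariety.snd B C) with ha
  set b : (A.prod B).prod C ⟶ A.prod (B.prod C) :=
    AbelianVariety.prodLift (AbelianVariety.fst (A.prod B) C ≫ AbelianVariety.fst A B)
      (AbelianVariety.prodLift (AbelianVariety.fst (A.prod B) C ≫ AbelianVariety.snd A B)
        (AbelianVariety.snd (A.prod B) C)) with hb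
  have hab : a ≫ b = 𝟙 (A.prod (B.prod C)) := by
    apply AbelianVariety.prod_hom_ext
    · simp only [ha, hb, Category.assoc, Category.id_comp, AbelianVariety.prodLift_fst,
        AbelianVariety.prodLift_fst_assoc]
    · apply AbelianVariety.prod_hom_ext <;>
      simp only [ha, hb, Category.assoc, Category.id_comp, AbelianVariety.prodLift_fst,
        AbelianVariety.prodLift_snd, AbelianVariety.prodLift_fst_assoc]
  have hba : b ≫ a = 𝟙 ((A.prod B).prod C) := by
    apply AbelianVariety.prod_hom_ext
    · apply AbelianVariety.prod_hom_ext <;>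
      simp only [ha, hb, Category.assoc, Category.id_comp, AbelianVariety.prodLift_fst,
        AbelianVariety.prodLift_snd, AbelianVariety.prodLift_snd_assoc]
    · simp only [ha, hb, Category.assoc, Category.id_comp, AbelianVariety.prodLift_snd,
        AbelianVariety.prodLift_snd_assoc]
  -- `b` intertwines the two bracketings of the diagonal structure
  have hequiv : b ≫ AbelianVariety.prodLift (AbelianVariety.fst A (B.prod C) ≫ α)
        (AbelianVariety.snd A (B.prod C) ≫
          AbelianVariety.prodLift (AbelianVariety.fst B C ≫ β) (AbelianVariety.snd B C ≫ γ)) =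
      AbelianVariety.prodLift
        (AbelianVariety.fst (A.prod B) C ≫
          AbelianVariety.prodLift (AbelianVariety.fst A B ≫ α) (AbelianVariety.snd A B ≫ β))
        (AbelianVariety.snd (A.prod B) C ≫ γ) ≫ b := by
    apply AbelianVariety.prod_hom_ext
    · simp only [hb, Category.assoc, AbelianVariety.prodLift_fst, AbelianVariety.prodLift_fst_assoc]
    · apply AbelianVariety.prod_hom_ext <;>
      simp only [hb, Category.assoc, AbelianVariety.prodLift_fst, AbelianVariety.prodLift_snd,
        AbelianVariety.prodLift_fst_assoc, AbelianVariety.prodLift_snd_assoc]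
  have hiso : AbelianVariety.IsIsogeny a := AbelianVariety.isIsogeny_hom_of_iso ⟨a, b, hab, hba⟩
  have hsq : AbelianVariety.prodLift
        (AbelianVariety.fst (A.prod B) C ≫
          AbelianVariety.prodLift (AbelianVariety.fst A B ≫ α) (AbelianVariety.snd A B ≫ β))
        (AbelianVariety.snd (A.prod B) C ≫ γ) ≫
      AbelianVariety.prodLift
        (AbelianVariety.fst (A.prod B) C ≫
          AbelianVariety.prodLift (AbelianVariety.fst A B ≫ α) (AbelianVariety.snd A B ≫ β))
        (AbelianVariety.snd (A.prod B) C ≫ γ) = -(d • 𝟙 ((A.prod B).prod C)) :=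
    prodLift_comp_self_eq_neg_nsmul (prodLift_comp_self_eq_neg_nsmul hα hβ) hγ
  have key := weilAlgebraicFor_of_descent (n := n) (m := 1) one_ne_zero hd.ne' hdim hiso
    (by rw [hab, Nat.cast_one, one_zsmul]) hsq (by rw [Nat.cast_one, one_zsmul]; exact hequiv) hW
  simpa only [one_pow, one_mul] using key

end Assoc

/-! ## §2 The split-sixfold slice `Y' × E₀²` in the shape consumed by part 2 -/

section Slice

variable {Y E₀ : AbelianVariety ℂ} {d : ℕ} {ψ : Y ⟶ Y} {ψ₀ : E₀ ⟶ E₀}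

/-- **Weil classes on the Weil-type `(3,3)` sixfolds `(Y' × (E₀ × E₀), ψ' × (ψ₀ × ψ₀))` (`Y'` a fourfold, `E₀` a
curve, any `K = ℚ(√-d)`) are algebraic granted Markman's hyperbolic-sixfold statement F2 ALONE** (UNREFEREED named
fact `hM`): re-associate (§1) to `((Y' × E₀) × E₀, (ψ' × ψ₀) × ψ₀)`, a Weil-type `fivefold × curve`, which is SPLIT
(AbelianAll seat, `isSplitWeilType_odd_prod_curve`), so F2 applies directly
(`weilClasses_algebraic_fivefold_prod_curve_of_markmanSixfolds`). This is exactly the input `h₃` of part 2's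
`hodgeConjectureFor_prod_prod_of_weilGenerated_of_splitSixfolds_of_floccariFu`.
[cite: Markman2025SecantWeil, Thm. 1.5.1 (preprint, unrefereed)] [cite: vanGeemen1994HodgeAV, Lemma 5.2 (2)–(4), 5.4 and (5.4.1)]
[cite: Landherr1936HermitianForms] -/
theorem weilAlgebraicFor_three_fourfold_prod_curve_sq_of_markmanSixfolds
    (hM : Markman2025_weilClasses_algebraic_hyperbolicSixfold) (hY : Y.dim = 4) (hE : E₀.dim = 1)
    (hd : 0 < d) (hψ : ψ ≫ ψ = -(d • 𝟙 Y)) (hψ₀ : ψ₀ ≫ ψ₀ = -(d • 𝟙 E₀))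
    (hW : IsWeilType (Y.prod (E₀.prod E₀))
      (AbelianVariety.prodLift (AbelianVariety.fst Y (E₀.prod E₀) ≫ ψ)
        (AbelianVariety.snd Y (E₀.prod E₀) ≫
          AbelianVariety.prodLift (AbelianVariety.fst E₀ E₀ ≫ ψ₀) (AbelianVariety.snd E₀ E₀ ≫ ψ₀))) 3 d) :
    WeilAlgebraicFor 3 d (Y.prod (E₀.prod E₀))
      (AbelianVariety.prodLift (AbelianVariety.fst Y (E₀.prod E₀) ≫ ψ)
        (AbelianVariety.snd Y (E₀.prod E₀) ≫
          AbelianVariety.prodLift (AbelianVariety.fst E₀ E₀ ≫ ψ₀) (AbelianVariety.snd E₀ E₀ ≫ ψ₀))) := by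
  have hW' := isWeilType_prod_prod_assoc hψ hψ₀ hψ₀ hW
  refine weilAlgebraicFor_prod_prod_assoc hd hψ hψ₀ hψ₀ hW.dim_eq ?_
  intro c hw hcQ hcH
  exact weilClasses_algebraic_fivefold_prod_curve_of_markmanSixfolds hM (A := Y.prod E₀)
    (by rw [AbelianVariety.dim_prod, hY, hE]) hE hd (prodLift_comp_self_eq_neg_nsmul hψ hψ₀) hψ₀ hW' hcQ hcH hw

/-- **The same for `K = ℚ(i)` granted Koike 2004 ALONE** (REFEREED named fact `hK`, hyperbolic-sixfold form):
`ψ'² = ψ₀² = -1`. [cite: Koike2004WeilHodge, Thm. 2.1 and Cor. 2.1] [cite: vanGeemen1994HodgeAV, (5.4.1)] -/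
theorem weilAlgebraicFor_three_fourfold_prod_curve_sq_of_koike
    (hK : Koike2004_weilClasses_algebraic_hyperbolicSixfold_one) (hY : Y.dim = 4) (hE : E₀.dim = 1)
    (hψ : ψ ≫ ψ = -((1 : ℕ) • 𝟙 Y)) (hψ₀ : ψ₀ ≫ ψ₀ = -((1 : ℕ) • 𝟙 E₀))
    (hW : IsWeilType (Y.prod (E₀.prod E₀))
      (AbelianVariety.prodLift (AbelianVariety.fst Y (E₀.prod E₀) ≫ ψ)
        (AbelianVariety.snd Y (E₀.prod E₀) ≫
          AbelianVariety.prodLift (AbelianVariety.fst E₀ E₀ ≫ ψ₀) (AbelianVariety.snd E₀ E₀ ≫ ψ₀))) 3 1) :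
    WeilAlgebraicFor 3 1 (Y.prod (E₀.prod E₀))
      (AbelianVariety.prodLift (AbelianVariety.fst Y (E₀.prod E₀) ≫ ψ)
        (AbelianVariety.snd Y (E₀.prod E₀) ≫
          AbelianVariety.prodLift (AbelianVariety.fst E₀ E₀ ≫ ψ₀) (AbelianVariety.snd E₀ E₀ ≫ ψ₀))) := by
  have hW' := isWeilType_prod_prod_assoc hψ hψ₀ hψ₀ hW
  refine weilAlgebraicFor_prod_prod_assoc one_pos hψ hψ₀ hψ₀ hW.dim_eq ?_
  intro c hw hcQ hcH
  exact weilClasses_algebraic_fivefold_prod_curve_of_koike hK (A := Y.prod E₀)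
    (by rw [AbelianVariety.dim_prod, hY, hE]) hE (prodLift_comp_self_eq_neg_nsmul hψ hψ₀) hψ₀ hW' hcQ hcH hw

/-- **The same for `K = ℚ(√-3)` granted Schoen 1998 ALONE** (REFEREED named fact `hS`): `ψ'² = ψ₀² = -3`.
[cite: Schoen1998HodgeWeilAddendum, §10] [cite: vanGeemen1994HodgeAV, 7.3 and (5.4.1)] -/
theorem weilAlgebraicFor_three_fourfold_prod_curve_sq_of_schoen
    (hS : Schoen1998_weilClasses_algebraic_hyperbolicSixfold_three) (hY : Y.dim = 4) (hE : E₀.dim = 1)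
    (hψ : ψ ≫ ψ = -((3 : ℕ) • 𝟙 Y)) (hψ₀ : ψ₀ ≫ ψ₀ = -((3 : ℕ) • 𝟙 E₀))
    (hW : IsWeilType (Y.prod (E₀.prod E₀))
      (AbelianVariety.prodLift (AbelianVariety.fst Y (E₀.prod E₀) ≫ ψ)
        (AbelianVariety.snd Y (E₀.prod E₀) ≫
          AbelianVariety.prodLift (AbelianVariety.fst E₀ E₀ ≫ ψ₀) (AbelianVariety.snd E₀ E₀ ≫ ψ₀))) 3 3) :
    WeilAlgebraicFor 3 3 (Y.prod (E₀.prod E₀))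
      (AbelianVariety.prodLift (AbelianVariety.fst Y (E₀.prod E₀) ≫ ψ)
        (AbelianVariety.snd Y (E₀.prod E₀) ≫
          AbelianVariety.prodLift (AbelianVariety.fst E₀ E₀ ≫ ψ₀) (AbelianVariety.snd E₀ E₀ ≫ ψ₀))) := by
  have hW' := isWeilType_prod_prod_assoc hψ hψ₀ hψ₀ hW
  refine weilAlgebraicFor_prod_prod_assoc (by norm_num) hψ hψ₀ hψ₀ hW.dim_eq ?_
  intro c hw hcQ hcH
  exact weilClasses_algebraic_fivefold_prod_curve_of_schoen hS (A := Y.prod E₀)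
    (by rw [AbelianVariety.dim_prod, hY, hE]) hE (prodLift_comp_self_eq_neg_nsmul hψ hψ₀) hψ₀ hW' hcQ hcH hw

end Slice

/-! ## §3 Tenfold rows, per member -/

section Carrier

variable {Y Z : AbelianVariety ℂ} {d : ℕ} {ψ : Y ⟶ Y} {χ : Z ⟶ Z}

/-- **HC for the tenfold `T = Y × Z × Z` (Weil type `(5,5)`, divisor-and-Weil-generated Hodge ring, any
`K = ℚ(√-d)`) from Floccari–Fu 2026 Thm. 1.2 (refereed named fact `h5`) and Markman's hyperbolic-sixfold statement
F2 (UNREFEREED named fact `hM`) — NO other input.** Part 2 + §2. KIND of `HC_CM`: ABSENT.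
[cite: FloccariFu2026, Theorem 1.2] [cite: Markman2025SecantWeil, Thm. 1.5.1 (preprint, unrefereed)]
[cite: Schoen1998HodgeWeilAddendum, §10] [cite: Deligne1982HodgeCycles, §5 (c)] -/
theorem hodgeConjectureFor_prod_prod_of_weilGenerated_of_markmanSixfolds_of_floccariFu
    (hM : Markman2025_weilClasses_algebraic_hyperbolicSixfold)
    (h5 : FloccariFu2026_hodgeClasses_algebraic_powers_discOneWeilFourfold) (hd : 0 < d) (hY : Y.dim = 4)
    (hZ : Z.dim = 3) (hψ : ψ ≫ ψ = -(d • 𝟙 Y)) (hχ : χ ≫ χ = -(d • 𝟙 Z))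
    (hT : IsWeilType (Y.prod (Z.prod Z))
      (AbelianVariety.prodLift (AbelianVariety.fst Y (Z.prod Z) ≫ ψ)
        (AbelianVariety.snd Y (Z.prod Z) ≫
          AbelianVariety.prodLift (AbelianVariety.fst Z Z ≫ χ) (AbelianVariety.snd Z Z ≫ χ))) 5 d)
    (hG : IsDivisorWeilGenerated (Y.prod (Z.prod Z))
      (AbelianVariety.prodLift (AbelianVariety.fst Y (Z.prod Z) ≫ ψ)
        (AbelianVariety.snd Y (Z.prod Z) ≫
          AbelianVariety.prodLift (AbelianVariety.fst Z Z ≫ χ) (AbelianVariety.snd Z Z ≫ χ))) 5 d) :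
    HodgeConjectureFor (Y.prod (Z.prod Z)).dim (Y.prod (Z.prod Z)).X :=
  hodgeConjectureFor_prod_prod_of_weilGenerated_of_splitSixfolds_of_floccariFu h5 hd hY hZ hψ hχ hT hG
    (fun _ _ hE hψ₀ hW ↦ weilAlgebraicFor_three_fourfold_prod_curve_sq_of_markmanSixfolds hM hY hE hd hψ hψ₀ hW)

/-- **REFEREED ROW, `K = ℚ(i)`: HC for the tenfold `T = Y × Z × Z` (Weil type `(5,5)` for `ℚ(i)`,
divisor-and-Weil-generated Hodge ring) from Floccari–Fu 2026 Thm. 1.2 and Koike 2004 — both refereed named facts,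
NO other input.** KIND of `HC_CM`: ABSENT. [cite: Koike2004WeilHodge, Thm. 2.1 and Cor. 2.1]
[cite: FloccariFu2026, Theorem 1.2] [cite: Schoen1998HodgeWeilAddendum, §10] -/
theorem hodgeConjectureFor_prod_prod_of_weilGenerated_of_koike_of_floccariFu
    (hK : Koike2004_weilClasses_algebraic_hyperbolicSixfold_one)
    (h5 : FloccariFu2026_hodgeClasses_algebraic_powers_discOneWeilFourfold) (hY : Y.dim = 4) (hZ : Z.dim = 3)
    (hψ : ψ ≫ ψ = -((1 : ℕ) • 𝟙 Y)) (hχ : χ ≫ χ = -((1 : ℕ) • 𝟙 Z))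
    (hT : IsWeilType (Y.prod (Z.prod Z))
      (AbelianVariety.prodLift (AbelianVariety.fst Y (Z.prod Z) ≫ ψ)
        (AbelianVariety.snd Y (Z.prod Z) ≫
          AbelianVariety.prodLift (AbelianVariety.fst Z Z ≫ χ) (AbelianVariety.snd Z Z ≫ χ))) 5 1)
    (hG : IsDivisorWeilGenerated (Y.prod (Z.prod Z))
      (AbelianVariety.prodLift (AbelianVariety.fst Y (Z.prod Z) ≫ ψ)
        (AbelianVariety.snd Y (Z.prod Z) ≫
          AbelianVariety.prodLift (AbelianVariety.fst Z Z ≫ χ) (AbelianVariety.snd Z Z ≫ χ))) 5 1) :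
    HodgeConjectureFor (Y.prod (Z.prod Z)).dim (Y.prod (Z.prod Z)).X :=
  hodgeConjectureFor_prod_prod_of_weilGenerated_of_splitSixfolds_of_floccariFu h5 one_pos hY hZ hψ hχ hT hG
    (fun _ _ hE hψ₀ hW ↦ weilAlgebraicFor_three_fourfold_prod_curve_sq_of_koike hK hY hE hψ hψ₀ hW)

/-- **REFEREED ROW, `K = ℚ(√-3)`: HC for the tenfold `T = Y × Z × Z` (Weil type `(5,5)` for `ℚ(√-3)`,
divisor-and-Weil-generated Hodge ring) from Floccari–Fu 2026 Thm. 1.2 and Schoen 1998 — both refereed named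
facts, NO other input.** KIND of `HC_CM`: ABSENT. [cite: Schoen1998HodgeWeilAddendum, §10]
[cite: FloccariFu2026, Theorem 1.2] [cite: Deligne1982HodgeCycles, §5 (c)] -/
theorem hodgeConjectureFor_prod_prod_of_weilGenerated_of_schoen_of_floccariFu
    (hS : Schoen1998_weilClasses_algebraic_hyperbolicSixfold_three)
    (h5 : FloccariFu2026_hodgeClasses_algebraic_powers_discOneWeilFourfold) (hY : Y.dim = 4) (hZ : Z.dim = 3)
    (hψ : ψ ≫ ψ = -((3 : ℕ) • 𝟙 Y)) (hχ : χ ≫ χ = -((3 : ℕ) • 𝟙 Z))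
    (hT : IsWeilType (Y.prod (Z.prod Z))
      (AbelianVariety.prodLift (AbelianVariety.fst Y (Z.prod Z) ≫ ψ)
        (AbelianVariety.snd Y (Z.prod Z) ≫
          AbelianVariety.prodLift (AbelianVariety.fst Z Z ≫ χ) (AbelianVariety.snd Z Z ≫ χ))) 5 3)
    (hG : IsDivisorWeilGenerated (Y.prod (Z.prod Z))
      (AbelianVariety.prodLift (AbelianVariety.fst Y (Z.prod Z) ≫ ψ)
        (AbelianVariety.snd Y (Z.prod Z) ≫
          AbelianVariety.prodLift (AbelianVariety.fst Z Z ≫ χ) (AbelianVariety.snd Z Z ≫ χ))) 5 3) :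
    HodgeConjectureFor (Y.prod (Z.prod Z)).dim (Y.prod (Z.prod Z)).X :=
  hodgeConjectureFor_prod_prod_of_weilGenerated_of_splitSixfolds_of_floccariFu h5 (by norm_num) hY hZ hψ hχ
    hT hG (fun _ _ hE hψ₀ hW ↦ weilAlgebraicFor_three_fourfold_prod_curve_sq_of_schoen hS hY hE hψ hψ₀ hW)

end Carrier

/-! ## §4 The carrier cells: `(S+G)_T` + Floccari–Fu + F2 -/

/-- **CELL ROW — the `Y₄/M × Z₃²` carrier cell from the typed cell hypothesis `(S+G)_T` (CELL INFERENCE, part 1;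
engine-certified on the cell's Mumford–Tate model, RELCHAR §5 carrier row `T10.Y4_MxZ3sq/k`; entered as an argument,
never asserted), Floccari–Fu 2026 Thm. 1.2 (refereed named fact) and Markman's hyperbolic-sixfold statement F2
(UNREFEREED named fact).** No tenfold input, no sixfold route item, no general fourfold fact. KIND of `HC_CM`:
ABSENT. [cite: FloccariFu2026, Theorem 1.2] [cite: Markman2025SecantWeil, Thm. 1.5.1 (preprint, unrefereed)]
[cite: MoonenZarhin1999LowDim, §2 (2.5)(2) and §5 Case 2] [cite: Schoen1998HodgeWeilAddendum, §10] -/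
theorem hodgeQuarticFieldFourfoldCMThreefoldSquaredCarrier_of_weilGenerated_of_markmanSixfolds_of_floccariFu
    (hSG : ∀ (Y Z : AbelianVariety ℂ) (ψ : Y ⟶ Y) (χ : Z ⟶ Z) (d : ℕ), 0 < d → IsQuarticFieldTypeIVFourfold Y →
      Z.dim = 3 → Z.IsSimple → IsField Z.endAlgebra → Module.finrank ℚ Z.endAlgebra = 6 →
      ψ ≫ ψ = -(d • 𝟙 Y) → χ ≫ χ = -(d • 𝟙 Z) →
      ∃ χ' : Z ⟶ Z, χ' ≫ χ' = -(d • 𝟙 Z) ∧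
        IsWeilType (Y.prod (Z.prod Z))
          (AbelianVariety.prodLift (AbelianVariety.fst Y (Z.prod Z) ≫ ψ)
            (AbelianVariety.snd Y (Z.prod Z) ≫
              AbelianVariety.prodLift (AbelianVariety.fst Z Z ≫ χ') (AbelianVariety.snd Z Z ≫ χ'))) 5 d ∧
        IsDivisorWeilGenerated (Y.prod (Z.prod Z))
          (AbelianVariety.prodLift (AbelianVariety.fst Y (Z.prod Z) ≫ ψ)
            (AbelianVariety.snd Y (Z.prod Z) ≫
              AbelianVariety.prodLift (AbelianVariety.fst Z Z ≫ χ') (AbelianVariety.snd Z Z ≫ χ'))) 5 d)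
    (hM : Markman2025_weilClasses_algebraic_hyperbolicSixfold)
    (h5 : FloccariFu2026_hodgeClasses_algebraic_powers_discOneWeilFourfold) :
    HodgeQuarticFieldFourfoldCMThreefoldSquaredCarrier :=
  hodgeQuarticFieldFourfoldCMThreefoldSquaredCarrier_of_weilGenerated_of_splitSixfolds_of_floccariFu hSG
    (fun _ _ _ _ _ hY' hE hψ' hψ₀ hW ↦
      weilAlgebraicFor_three_fourfold_prod_curve_sq_of_markmanSixfolds hM hY' hE hW.d_pos hψ' hψ₀ hW) h5

/-- **CELL ROW — the `Y₄(3,1) × Z₃²` carrier cell from `(S+G)_T` (CELL INFERENCE, part 1; carrier row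
`T10.Y4xZ3sq/k.(3,1)`; entered as an argument, never asserted), Floccari–Fu 2026 Thm. 1.2 (refereed) and Markman's
F2 (UNREFEREED).** KIND of `HC_CM`: ABSENT. [cite: FloccariFu2026, Theorem 1.2]
[cite: Markman2025SecantWeil, Thm. 1.5.1 (preprint, unrefereed)] [cite: MoonenZarhin1998WeilClasses, Criterion (4.1)]
[cite: Schoen1998HodgeWeilAddendum, §10] -/
theorem hodgeQuadraticFourfold31CMThreefoldSquaredCarrier_of_weilGenerated_of_markmanSixfolds_of_floccariFu
    (hSG : ∀ (Y Z : AbelianVariety ℂ) (ψ : Y ⟶ Y) (χ : Z ⟶ Z) (d : ℕ), 0 < d →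
      Y.dim = 4 → Y.IsSimple → Module.finrank ℚ Y.endAlgebra = 2 →
      Z.dim = 3 → Z.IsSimple → IsField Z.endAlgebra → Module.finrank ℚ Z.endAlgebra = 6 →
      ψ ≫ ψ = -(d • 𝟙 Y) → χ ≫ χ = -(d • 𝟙 Z) →
      (eigenMultiplicity Y ψ (Complex.I * (Real.sqrt d : ℂ)) = 1 ∨
        eigenMultiplicity Y ψ (-(Complex.I * (Real.sqrt d : ℂ))) = 1) →
      ∃ χ' : Z ⟶ Z, χ' ≫ χ' = -(d • 𝟙 Z) ∧
        IsWeilType (Y.prod (Z.prod Z))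
          (AbelianVariety.prodLift (AbelianVariety.fst Y (Z.prod Z) ≫ ψ)
            (AbelianVariety.snd Y (Z.prod Z) ≫
              AbelianVariety.prodLift (AbelianVariety.fst Z Z ≫ χ') (AbelianVariety.snd Z Z ≫ χ'))) 5 d ∧
        IsDivisorWeilGenerated (Y.prod (Z.prod Z))
          (AbelianVariety.prodLift (AbelianVariety.fst Y (Z.prod Z) ≫ ψ)
            (AbelianVariety.snd Y (Z.prod Z) ≫
              AbelianVariety.prodLift (AbelianVariety.fst Z Z ≫ χ') (AbelianVariety.snd Z Z ≫ χ'))) 5 d)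
    (hM : Markman2025_weilClasses_algebraic_hyperbolicSixfold)
    (h5 : FloccariFu2026_hodgeClasses_algebraic_powers_discOneWeilFourfold) :
    HodgeQuadraticFourfold31CMThreefoldSquaredCarrier :=
  hodgeQuadraticFourfold31CMThreefoldSquaredCarrier_of_weilGenerated_of_splitSixfolds_of_floccariFu hSG
    (fun _ _ _ _ _ hY' hE hψ' hψ₀ hW ↦
      weilAlgebraicFor_three_fourfold_prod_curve_sq_of_markmanSixfolds hM hY' hE hW.d_pos hψ' hψ₀ hW) h5

end Summit.HodgeConjecture.HodgeConjecture.Ring2.Atlas
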